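import Summits.QuantumFields.BalabanUV.Beta.GAN24.EEWordReduced
import Summits.QuantumFields.BalabanUV.Beta.GAN24.DressedHalfVertex

/-!
# `BalabanUV.Beta.GAN24.ExitFaceLeftFamily` — binder row G-an2-4 ∕ (CONV-C), W-slot (α-0), ROW (C) AT LEVELS `j ≥ 1`, letter (W5) of the (γ) hand's memo
# `HOME/b2b-balaban-gan24-formalise-leaf-06/g52/C-LEVELS-GE1.md` §17: **THE EXIT-FACE-READ LEFT FAMILY OF THE LEVEL-`j` EXCHANGE WORD FOR A GENERIC LOCAL STENCIL FAMILY —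
# covariance, decay off the source, summability against bounded forms, and its bond resummation to the two-face half-vertex** — leaf-04's `EEWordReduced` §1 with the
# Wilson table `cE • wilsonA` replaced by ANY fine-translation-covariant `LocStencil` family `S` (so that the E-sector `S^E_j ∝ e3OfK Lc G_{j−1} (SrecAt (j−1))` of every level is covered:
# `ValueJetGeneric.e3OfK_translate` ∕ `locStencil_e3OfK`), every `j`, in-block root, every `d`, `Lc ≥ 1`
# (G-an2-4 CRUX TEAM (2), seat `b2b-balaban-gan24-formalise-leaf-06` = the (γ) hand, gen 52; journal INTENT I-leaf06-g52-7)

NOT IN PRINT; OUR BOOKKEEPING ([folklore] BY NAME: leaf-04's `EEWordReduced.shiftK_dressedStep` ∕ `leftFamily_cov` pattern, an4's `OneStepKernelFamily.vertexOfK_translate` ∕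
`vertexFamily_vertexOfK`, leaf-04's level-generic slot resummation `DressedHalfVertex.hasSum_vertexOfK_dressedStep`, `decays_coDressKBmAt` ∕ `decays_unitK` ∕ `locStencil_unitS`;
0 `def`, 0 cited fact, 0 `def … : Prop`, 0 sorry).
HONEST FRAMING (cell contract, verbatim): «discharging `BetaPertH` makes Bałaban's UV stability UNCONDITIONAL — a real constructive-QFT result; it is NOT the continuum
limit and NOT the Clay problem.»  HONEST DEPENDENCY (verbatim): «continuum YM on T⁴ ⇐ BetaPertH ∧ nine spine estimates (0/9 proved); BetaPertH ⇐ (D1) ∧ (D4) ∧ CAP+tail;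
G-an2-4 gates asym, D1 and NE2/3/4.»

WHY (memo §17 (W5)).  The direct exchange word of `zmode Lc b̃_j` keeps its FIRST background slot per coarse bond `u ∈ box` (`DressedSourceZeroModeWords`); leaf-04's
`CoarseBondCellPairing.sum_box_tsum_sum_mul_periodic_of_cov` turns `Σ_{u∈box} Σ'_{y₁} Σ_a j_u(a,y₁)·B(a,y₁)` into the cell pairing of the RESUMMED family `Σ'_u j_u` with `B` once `j_u` is
coarse-bond covariant and summable against bounded `B` — leaf-04 typed these for the Wilson table (`EEWordReduced` §1); the level-`j` E-sector table is `(cE·wE_j) • e3OfK Lc G_{j−1} (SrecAt (j−1))`,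
fine-translation covariant and a local stencil family, so here the same three facts are typed for a GENERIC such `S`, plus the bond resummation of the left family (§3) which lands it on
the face–face half-vertex that `ExitFaceHalfVertexSplit` splits.
* §1 `unitS_translate_of_translate`, **`leftFamily_cov_of_translate`** — `j_{u+t}(a, y₁ + Lc•t) = j_u(a, y₁)`.
* §2 **`abs_leftFamily_le_of_locStencil`**, **`summable_leftFamily_mul_of_locStencil`**.
* §3 **`tsum_leftFamily_eq_faceface`** — `Σ'_u j_u(a,y₁) = c₀σ_j·Σ'_y χ_α(y)·Σ'_t χ_μ(t)·S μ t y y₁ (inl α)(inl a)` (Fubini + `hasSum_vertexOfK_dressedStep`).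
Asserts NO value of Bałaban's tables; discharges NOTHING of (C) ∕ (C)sym ∕ (Q-L) ∕ «T2Shape» ∕ «T2Drift» ∕ (hW, hWall); NEVER «G-an2-4 closed» as (CONV-C); NOT D1, NOT
`BetaPertH`, NOT continuum, NOT Clay.  2026-08-23; no existing file touched.
-/

noncomputable section

open Finset
open scoped BigOperators
open Literature.MathematicalPhysics.QuantumFieldTheory
open Literature.MathematicalPhysics.QuantumFieldTheory.Balaban1983to89
open Literature.MathematicalPhysics.QuantumFieldTheory.Balaban1983to89.Beta
open B12Sec2to5 (l1 l1_nonneg)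
open ExpKernelCalculus (Site MKer shiftK Decays BiLoc VertexFamily Zl summable_exp_shift summable_exp_shift' l1_sub_triangle l1_sub_symm)
open OneStepResolventKernel (Fib LocStencil)
open OneStepKernelFamily (KInvStep vertexOfK vertexOfK_translate vertexFamily_vertexOfK decays_KInvStep)
open AffineAveraging (Form1 box toSite)
open Summit.QuantumFields.BalabanUV.Beta.AxialDressingRooted (coDressKBmAt decays_coDressKBmAt)
open Summit.QuantumFields.BalabanUV.Beta.HessKerDressedUnits (unitK unitS counitK decays_unitK locStencil_unitS)
open Summit.QuantumFields.BalabanUV.Beta.GAN24.EEWordReduced (shiftK_dressedStep)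
open Summit.QuantumFields.BalabanUV.Beta.GAN24.DressedHalfVertex (hasSum_vertexOfK_dressedStep)

namespace Summit.QuantumFields.BalabanUV.Beta.GAN24.ExitFaceLeftFamily

variable {d : ℕ} {Lc : ℕ} [NeZero Lc] {r : Fin (d + 1) → ℕ}
variable {S : Fin (d + 1) → (Fin (d + 1) → ℤ) → MKer (d + 1) (Fib d)}

/-! ## §1 Covariance -/

omit [NeZero Lc] in
/-- [folklore] Units commute with translations: a fine-translation-covariant family stays covariant under `unitS`. -/
theorem unitS_translate_of_translate (hSt : ∀ (κ : Fin (d + 1)) (u v : Fin (d + 1) → ℤ), S κ (u + v) = shiftK (-v) (S κ u)) (sf sm : ℝ)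
    (κ : Fin (d + 1)) (u v : Fin (d + 1) → ℤ) : unitS sf sm S κ (u + v) = shiftK (-v) (unitS sf sm S κ u) := by
  funext x z a b
  simp only [HessKerDressedUnits.unitS_apply, shiftK, hSt κ u v]

variable {μ α : Fin (d + 1)}

/-- [folklore] **THE LEFT FAMILY IS COARSE-BOND COVARIANT** (generic table): for a fine-translation-covariant `S`,
`j_{u+t}(a, y₁ + Lc•t) = j_u(a, y₁)`, `j_u(a, y₁) := Σ'_y χ_α(y)·vertexOfK X̃♮_j Lc (unitS sf sm S) μ u y y₁ (inl α)(inl a)`. -/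
theorem leftFamily_cov_of_translate (hLc : 1 ≤ Lc) (hSt : ∀ (κ : Fin (d + 1)) (u v : Fin (d + 1) → ℤ), S κ (u + v) = shiftK (-v) (S κ u)) (sf sm : ℝ) (j : ℕ)
    (u : Site (d + 1)) (a : Fin (d + 1)) (y₁ t : Site (d + 1)) :
    ∑' y : Site (d + 1), (if y α % (Lc : ℤ) = (Lc : ℤ) - 1 then (1 : ℝ) else 0) *
        vertexOfK (unitK sf sm (coDressKBmAt (toSite r) Lc (KInvStep (d := d) Lc j))) Lc (unitS sf sm S) μ (u + t) y (y₁ + (Lc : ℤ) • t) (Sum.inl α) (Sum.inl a) =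
      ∑' y : Site (d + 1), (if y α % (Lc : ℤ) = (Lc : ℤ) - 1 then (1 : ℝ) else 0) *
        vertexOfK (unitK sf sm (coDressKBmAt (toSite r) Lc (KInvStep (d := d) Lc j))) Lc (unitS sf sm S) μ u y y₁ (Sum.inl α) (Sum.inl a) := by
  have hV := vertexOfK_translate (N := Lc) (shiftK_dressedStep (r := r) hLc sf sm j) (unitS_translate_of_translate hSt sf sm) μ u t
  simp only [hV, shiftK, add_neg_cancel_right]
  have hf : ∀ y : Site (d + 1), (if (y + -((Lc : ℤ) • t)) α % (Lc : ℤ) = (Lc : ℤ) - 1 then (1 : ℝ) else 0) = (if y α % (Lc : ℤ) = (Lc : ℤ) - 1 then (1 : ℝ) else 0) := by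
    intro y
    have e : (y + -((Lc : ℤ) • t)) α % (Lc : ℤ) = y α % (Lc : ℤ) := by
      simp only [Pi.add_apply, Pi.neg_apply, Pi.smul_apply, smul_eq_mul]
      rw [show y α + -((Lc : ℤ) * t α) = y α + (Lc : ℤ) * (-t α) by ring, Int.add_mul_emod_self_left]
    simp only [e]
  calc ∑' y : Site (d + 1), (if y α % (Lc : ℤ) = (Lc : ℤ) - 1 then (1 : ℝ) else 0) *
        vertexOfK (unitK sf sm (coDressKBmAt (toSite r) Lc (KInvStep (d := d) Lc j))) Lc (unitS sf sm S) μ u (y + -((Lc : ℤ) • t)) y₁ (Sum.inl α) (Sum.inl a)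
      = ∑' y : Site (d + 1), (if (y + -((Lc : ℤ) • t)) α % (Lc : ℤ) = (Lc : ℤ) - 1 then (1 : ℝ) else 0) *
        vertexOfK (unitK sf sm (coDressKBmAt (toSite r) Lc (KInvStep (d := d) Lc j))) Lc (unitS sf sm S) μ u (y + -((Lc : ℤ) • t)) y₁ (Sum.inl α) (Sum.inl a) :=
          tsum_congr fun y => by rw [hf]
    _ = _ := (Equiv.addRight (-((Lc : ℤ) • t))).tsum_eq (fun y : Site (d + 1) => (if y α % (Lc : ℤ) = (Lc : ℤ) - 1 then (1 : ℝ) else 0) *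
        vertexOfK (unitK sf sm (coDressKBmAt (toSite r) Lc (KInvStep (d := d) Lc j))) Lc (unitS sf sm S) μ u y y₁ (Sum.inl α) (Sum.inl a))

/-! ## §2 Decay off the source; summability -/

/-- [folklore] **THE LEFT FAMILY DECAYS OFF ITS SOURCE** (generic local stencil family `S` at a positive rate):
`|j_u(a, y₁)| ≤ (C_v·Σ'_y e^{−δ_v|y − Lc•u|})·e^{−δ_v|y₁ − Lc•u|}`. -/
theorem abs_leftFamily_le_of_locStencil (hLc : 1 ≤ Lc) (hr : r ∈ box (d + 1) Lc) {Cs δs : ℝ} (hS : LocStencil S Cs δs) (hδs : 0 < δs) (sf sm : ℝ) (j : ℕ) :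
    ∃ Cv δv : ℝ, 0 < δv ∧ 0 ≤ Cv ∧ ∀ (u : Site (d + 1)) (a : Fin (d + 1)) (y₁ : Site (d + 1)),
      |∑' y : Site (d + 1), (if y α % (Lc : ℤ) = (Lc : ℤ) - 1 then (1 : ℝ) else 0) *
          vertexOfK (unitK sf sm (coDressKBmAt (toSite r) Lc (KInvStep (d := d) Lc j))) Lc (unitS sf sm S) μ u y y₁ (Sum.inl α) (Sum.inl a)| ≤
        (Cv * ∑' y : Site (d + 1), Real.exp (-δv * l1 (y - (Lc : ℤ) • u))) * Real.exp (-δv * l1 (y₁ - (Lc : ℤ) • u)) := by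
  obtain ⟨δK, CK, hδK, hCK, hXd⟩ := decays_coDressKBmAt hLc hr (decays_KInvStep (d := d) (Lc := Lc) j)
  have hXu := decays_unitK (sf := sf) (sm := sm) hXd
  have hSu := locStencil_unitS (sf := sf) (sm := sm) hS
  have hC : 0 ≤ max |sf| |sm| * CK * max |sf| |sm| := by positivity
  -- common rate
  set m : ℝ := min δK δs with hm
  have hm0 : 0 < m := lt_min hδK hδs
  have hCs' : 0 ≤ |(sf * sm)⁻¹| * (max |sf⁻¹| |sm⁻¹| * Cs * max |sf⁻¹| |sm⁻¹|) := by
    have : 0 ≤ Cs := (hS 0 0).nonneg (Sum.inl 0)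
    positivity
  have hSm : LocStencil (unitS sf sm S) (|(sf * sm)⁻¹| * (max |sf⁻¹| |sm⁻¹| * Cs * max |sf⁻¹| |sm⁻¹|)) m :=
    BalabanStepJets.locStencil_mono hSu hCs' (min_le_right _ _)
  obtain ⟨Cv, hVF⟩ : ∃ Cv : ℝ, VertexFamily (vertexOfK (unitK sf sm (coDressKBmAt (toSite r) Lc (KInvStep (d := d) Lc j))) Lc (unitS sf sm S)) Lc Cv (m / 2) :=
    ⟨_, vertexFamily_vertexOfK (N := Lc) hXu hC hSm hm0 (min_le_left _ _)⟩
  set V := vertexOfK (unitK sf sm (coDressKBmAt (toSite r) Lc (KInvStep (d := d) Lc j))) Lc (unitS sf sm S) with hVdef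
  have hCv0 : 0 ≤ Cv := (hVF μ 0).nonneg (Sum.inl 0)
  refine ⟨Cv, m / 2, half_pos hm0, hCv0, fun u a y₁ => ?_⟩
  have hpt : ∀ y : Site (d + 1), |(if y α % (Lc : ℤ) = (Lc : ℤ) - 1 then (1 : ℝ) else 0) * V μ u y y₁ (Sum.inl α) (Sum.inl a)| ≤
      Cv * Real.exp (-(m / 2) * l1 (y - (Lc : ℤ) • u)) * Real.exp (-(m / 2) * l1 (y₁ - (Lc : ℤ) • u)) := by
    intro y
    rw [abs_mul]
    have h1 : |(if y α % (Lc : ℤ) = (Lc : ℤ) - 1 then (1 : ℝ) else 0)| ≤ 1 := by split_ifs <;> simp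
    have h2 := hVF μ u y y₁ (Sum.inl α) (Sum.inl a)
    rw [mul_add, Real.exp_add, ← mul_assoc] at h2
    calc |(if y α % (Lc : ℤ) = (Lc : ℤ) - 1 then (1 : ℝ) else 0)| * |V μ u y y₁ (Sum.inl α) (Sum.inl a)|
        ≤ 1 * (Cv * Real.exp (-(m / 2) * l1 (y - (Lc : ℤ) • u)) * Real.exp (-(m / 2) * l1 (y₁ - (Lc : ℤ) • u))) :=
          mul_le_mul h1 h2 (abs_nonneg _) zero_le_one
      _ = _ := one_mul _
  have hZ : Summable fun y : Site (d + 1) => Real.exp (-(m / 2) * l1 (y - (Lc : ℤ) • u)) := summable_exp_shift' (half_pos hm0) ((Lc : ℤ) • u)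
  have hmaj : Summable fun y : Site (d + 1) => Cv * Real.exp (-(m / 2) * l1 (y - (Lc : ℤ) • u)) * Real.exp (-(m / 2) * l1 (y₁ - (Lc : ℤ) • u)) :=
    (hZ.mul_left Cv).mul_right _
  have hsy : Summable fun y : Site (d + 1) => ‖(if y α % (Lc : ℤ) = (Lc : ℤ) - 1 then (1 : ℝ) else 0) * V μ u y y₁ (Sum.inl α) (Sum.inl a)‖ :=
    Summable.of_nonneg_of_le (fun _ => norm_nonneg _) (fun y => by rw [Real.norm_eq_abs]; exact hpt y) hmaj
  calc |∑' y : Site (d + 1), (if y α % (Lc : ℤ) = (Lc : ℤ) - 1 then (1 : ℝ) else 0) * V μ u y y₁ (Sum.inl α) (Sum.inl a)|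
      ≤ ∑' y : Site (d + 1), ‖(if y α % (Lc : ℤ) = (Lc : ℤ) - 1 then (1 : ℝ) else 0) * V μ u y y₁ (Sum.inl α) (Sum.inl a)‖ := by
        rw [← Real.norm_eq_abs]; exact norm_tsum_le_tsum_norm hsy
    _ ≤ ∑' y : Site (d + 1), Cv * Real.exp (-(m / 2) * l1 (y - (Lc : ℤ) • u)) * Real.exp (-(m / 2) * l1 (y₁ - (Lc : ℤ) • u)) :=
        Summable.tsum_le_tsum (fun y => by rw [Real.norm_eq_abs]; exact hpt y) hsy hmaj
    _ = (Cv * ∑' y : Site (d + 1), Real.exp (-(m / 2) * l1 (y - (Lc : ℤ) • u))) * Real.exp (-(m / 2) * l1 (y₁ - (Lc : ℤ) • u)) := by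
        rw [tsum_mul_right, tsum_mul_left]

/-- [folklore] **THE LEFT FAMILY IS SUMMABLE AGAINST ANY BOUNDED FORM** (generic `S`). -/
theorem summable_leftFamily_mul_of_locStencil (hLc : 1 ≤ Lc) (hr : r ∈ box (d + 1) Lc) {Cs δs : ℝ} (hS : LocStencil S Cs δs) (hδs : 0 < δs) (sf sm : ℝ) (j : ℕ)
    {B : Site (d + 1) → ℝ} {M : ℝ} (hB : ∀ y, |B y| ≤ M) (u : Site (d + 1)) (a : Fin (d + 1)) :
    Summable fun y₁ : Site (d + 1) => (∑' y : Site (d + 1), (if y α % (Lc : ℤ) = (Lc : ℤ) - 1 then (1 : ℝ) else 0) *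
        vertexOfK (unitK sf sm (coDressKBmAt (toSite r) Lc (KInvStep (d := d) Lc j))) Lc (unitS sf sm S) μ u y y₁ (Sum.inl α) (Sum.inl a)) * B y₁ := by
  obtain ⟨Cv, δv, hδv, hCv, hle⟩ := abs_leftFamily_le_of_locStencil (μ := μ) (α := α) hLc hr hS hδs sf sm j
  have hM : 0 ≤ M := (abs_nonneg _).trans (hB 0)
  have hZ0 : 0 ≤ ∑' y : Site (d + 1), Real.exp (-δv * l1 (y - (Lc : ℤ) • u)) := tsum_nonneg fun _ => (Real.exp_pos _).le
  refine Summable.of_norm_bounded ((((summable_exp_shift' hδv ((Lc : ℤ) • u)).mul_left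
    (Cv * ∑' y : Site (d + 1), Real.exp (-δv * l1 (y - (Lc : ℤ) • u)))).mul_right M)) (fun y₁ => ?_)
  rw [Real.norm_eq_abs, abs_mul]
  exact mul_le_mul (hle u a y₁) (hB y₁) (abs_nonneg _) (by positivity)

/-! ## §3 Bond resummation of the left family -/

/-- [folklore] **THE BOND-RESUMMED LEFT FAMILY IS THE TWO-FACE HALF-VERTEX** (generic `S`, every `j`):
`Σ'_u j_u(a, y₁) = c₀σ_j·Σ'_y χ_α(y)·Σ'_t χ_μ(t)·(unitS sf sm S) μ t y y₁ (inl α)(inl a)`, `c₀σ_j = (Lc·s_m s_f)·((Lc^{j+1})^{d+2})⁻¹`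
(joint summability of `(u, y) ↦ χ_α(y)·V μ u y y₁` from the `VertexFamily` bound, then leaf-04's `hasSum_vertexOfK_dressedStep` pointwise in `y`). -/
theorem tsum_leftFamily_eq_faceface (hLc : 1 ≤ Lc) (hr : r ∈ box (d + 1) Lc) {Cs δs : ℝ} (hS : LocStencil S Cs δs) (hδs : 0 < δs) (sf sm : ℝ) (j : ℕ)
    (a : Fin (d + 1)) (y₁ : Site (d + 1)) :
    ∑' u : Site (d + 1), ∑' y : Site (d + 1), (if y α % (Lc : ℤ) = (Lc : ℤ) - 1 then (1 : ℝ) else 0) *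
        vertexOfK (unitK sf sm (coDressKBmAt (toSite r) Lc (KInvStep (d := d) Lc j))) Lc (unitS sf sm S) μ u y y₁ (Sum.inl α) (Sum.inl a) =
      ((Lc : ℝ) * (sm * sf)) * ((((Lc ^ (j + 1) : ℕ) : ℝ)) ^ (d + 1 + 1))⁻¹ *
        ∑' y : Site (d + 1), (if y α % (Lc : ℤ) = (Lc : ℤ) - 1 then (1 : ℝ) else 0) *
          ∑' t : Site (d + 1), (if t μ % (Lc : ℤ) = (Lc : ℤ) - 1 then unitS sf sm S μ t y y₁ (Sum.inl α) (Sum.inl a) else 0) := by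
  obtain ⟨δK, CK, hδK, hCK, hXd⟩ := decays_coDressKBmAt hLc hr (decays_KInvStep (d := d) (Lc := Lc) j)
  have hXu := decays_unitK (sf := sf) (sm := sm) hXd
  have hSu := locStencil_unitS (sf := sf) (sm := sm) hS
  have hC : 0 ≤ max |sf| |sm| * CK * max |sf| |sm| := by positivity
  set m : ℝ := min δK δs with hm
  have hm0 : 0 < m := lt_min hδK hδs
  have hCs' : 0 ≤ |(sf * sm)⁻¹| * (max |sf⁻¹| |sm⁻¹| * Cs * max |sf⁻¹| |sm⁻¹|) := by
    have : 0 ≤ Cs := (hS 0 0).nonneg (Sum.inl 0)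
    positivity
  have hSm : LocStencil (unitS sf sm S) (|(sf * sm)⁻¹| * (max |sf⁻¹| |sm⁻¹| * Cs * max |sf⁻¹| |sm⁻¹|)) m :=
    BalabanStepJets.locStencil_mono hSu hCs' (min_le_right _ _)
  obtain ⟨Cv, hVF⟩ : ∃ Cv : ℝ, VertexFamily (vertexOfK (unitK sf sm (coDressKBmAt (toSite r) Lc (KInvStep (d := d) Lc j))) Lc (unitS sf sm S)) Lc Cv (m / 2) :=
    ⟨_, vertexFamily_vertexOfK (N := Lc) hXu hC hSm hm0 (min_le_left _ _)⟩
  set V := vertexOfK (unitK sf sm (coDressKBmAt (toSite r) Lc (KInvStep (d := d) Lc j))) Lc (unitS sf sm S) with hVdef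
  have hCv0 : 0 ≤ Cv := (hVF μ 0).nonneg (Sum.inl 0)
  set δ₂ : ℝ := m / 2 with hδ₂
  have hδ₂0 : 0 < δ₂ := half_pos hm0
  -- joint summability of `(u, y) ↦ χ_α(y)·V μ u y y₁`: majorant `Cv·e^{−δ₂|y − Lc•u|}·e^{−δ₂|y₁ − Lc•u|}`
  set F : Site (d + 1) × Site (d + 1) → ℝ := fun q => (if q.2 α % (Lc : ℤ) = (Lc : ℤ) - 1 then (1 : ℝ) else 0) * V μ q.1 q.2 y₁ (Sum.inl α) (Sum.inl a) with hF
  have hFle : ∀ q : Site (d + 1) × Site (d + 1), |F q| ≤ (Cv * Real.exp (-δ₂ * l1 (y₁ - (Lc : ℤ) • q.1))) * Real.exp (-δ₂ * l1 (q.2 - (Lc : ℤ) • q.1)) := by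
    intro q
    rw [hF, abs_mul]
    have h1 : |(if q.2 α % (Lc : ℤ) = (Lc : ℤ) - 1 then (1 : ℝ) else 0)| ≤ 1 := by split_ifs <;> simp
    have h2 := hVF μ q.1 q.2 y₁ (Sum.inl α) (Sum.inl a)
    calc |(if q.2 α % (Lc : ℤ) = (Lc : ℤ) - 1 then (1 : ℝ) else 0)| * |V μ q.1 q.2 y₁ (Sum.inl α) (Sum.inl a)|
        ≤ 1 * (Cv * Real.exp (-δ₂ * (l1 (q.2 - (Lc : ℤ) • q.1) + l1 (y₁ - (Lc : ℤ) • q.1)))) := mul_le_mul h1 h2 (abs_nonneg _) zero_le_one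
      _ = _ := by rw [one_mul, mul_add, Real.exp_add]; ring
  -- inner sum in `y` for fixed `u`, then the `u` sum: `Σ_u e^{−δ₂|y₁ − Lc u|}·Zl`
  have hin : ∀ u : Site (d + 1), HasSum (fun y : Site (d + 1) => (Cv * Real.exp (-δ₂ * l1 (y₁ - (Lc : ℤ) • u))) * Real.exp (-δ₂ * l1 (y - (Lc : ℤ) • u)))
      ((Cv * Real.exp (-δ₂ * l1 (y₁ - (Lc : ℤ) • u))) * Zl (d + 1) δ₂) := by
    intro u
    have h := (summable_exp_shift' hδ₂0 ((Lc : ℤ) • u)).hasSum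
    rw [show (∑' y : Site (d + 1), Real.exp (-δ₂ * l1 (y - (Lc : ℤ) • u))) = Zl (d + 1) δ₂ from by
      rw [← ExpKernelCalculus.tsum_exp_shift ((Lc : ℤ) • u)]; exact tsum_congr fun y => by rw [l1_sub_symm]] at h
    exact h.mul_left _
  have hout : Summable fun u : Site (d + 1) => (Cv * Real.exp (-δ₂ * l1 (y₁ - (Lc : ℤ) • u))) * Zl (d + 1) δ₂ := by
    have hsub := (summable_exp_shift hδ₂0 y₁).comp_injective (InterLevelTransport.sublattice_injective Lc (0 : Site (d + 1)))
    refine ((hsub.mul_left Cv).mul_right (Zl (d + 1) δ₂)).congr fun u => ?_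
    simp only [Function.comp_apply, add_zero]
  have hM0 : Summable fun q : Site (d + 1) × Site (d + 1) => (Cv * Real.exp (-δ₂ * l1 (y₁ - (Lc : ℤ) • q.1))) * Real.exp (-δ₂ * l1 (q.2 - (Lc : ℤ) • q.1)) := by
    refine (summable_prod_of_nonneg fun q => by positivity).2 ⟨fun u => (hin u).summable, ?_⟩
    exact hout.congr fun u => ((hin u).tsum_eq).symm
  have hFs : Summable F := Summable.of_norm_bounded hM0 fun q => by rw [Real.norm_eq_abs]; exact hFle q
  -- Fubini: `Σ'_u Σ'_y F (u,y) = Σ'_y Σ'_u F (u,y)`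
  have hcomm : (∑' u : Site (d + 1), ∑' y : Site (d + 1), (if y α % (Lc : ℤ) = (Lc : ℤ) - 1 then (1 : ℝ) else 0) * V μ u y y₁ (Sum.inl α) (Sum.inl a)) =
      ∑' y : Site (d + 1), ∑' u : Site (d + 1), (if y α % (Lc : ℤ) = (Lc : ℤ) - 1 then (1 : ℝ) else 0) * V μ u y y₁ (Sum.inl α) (Sum.inl a) :=
    (Summable.tsum_comm (f := fun u y => (if y α % (Lc : ℤ) = (Lc : ℤ) - 1 then (1 : ℝ) else 0) * V μ u y y₁ (Sum.inl α) (Sum.inl a)) hFs).symm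
  rw [hcomm, ← tsum_mul_left]
  refine tsum_congr fun y => ?_
  rw [tsum_mul_left, hVdef, (hasSum_vertexOfK_dressedStep hLc hr sf sm j μ hSu hδs y y₁ (Sum.inl α) (Sum.inl a)).tsum_eq]
  ring

end Summit.QuantumFields.BalabanUV.Beta.GAN24.ExitFaceLeftFamily

end
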